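import Mathlib.Tactic
import HarnessLib
import HarnessLib.Audit.Tags
import Summits.CriticalPhenomena.PercolationContinuityZ3.Theorems.PercNearOneGluingNoHeavyLowerTailSahiAntichainLinear
import Summits.CriticalPhenomena.PercolationContinuityZ3.Theorems.PercNearOneGluingNoHeavyLowerTailSahiAntichainSplitThree
import Summits.CriticalPhenomena.PercolationContinuityZ3.Theorems.PercNearOneGluingNoHeavyLowerTailSahiAntichainFourSeven

/-!
# Antichains, meets plus joins: the small-side statement for sides of at most four members, and its reduction to two lemmas

Support file (seat `prim-masterthm-p1`, gen 37; `--supports stmt-CriticalPhenomena-4575`).  No `sorry`, no new definitions, standard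
axioms.  Memo `run/shared/lean/prim/prim-masterthm/FROM-prim-masterthm-p1-g37-LINEAR-REDUCTION.md` §2.

SETTING: `…SahiAntichainLinear` reduced V5 (indeed `f ≥ 2N` for `N ≥ 7`) to the typed statements `AntichainMidRange` and
`AntichainSmallSide`; the latter asks, at a point with at most six members above and at least seven below, for
`2 #(above) ≤ f (above) + newLabels`.

NEW HERE ([this work], gen 37).
* `smallSide_of_card_above_le_four`: **the small-side inequality holds UNCONDITIONALLY for every side of at most four members**
  (opposite any non-empty side): one or two members give two new labels (kernel steps) and `f ≥ 2p − 2`; three members are a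
  (co)sunflower (two new labels, `f ≥ 4`) or have `f ≥ 5` and one new label (`…SplitThree`); four members have `f ≥ 8`, or `f = 7` and
  then they form a (co)sunflower (`…FourSeven`) and the (co)sunflower step gives two new labels.
* `antichainSmallSide_of`: **`AntichainSmallSide` follows from two remaining finite lemmas** — «L3» every five-member antichain has at
  least ten labels (kernel: nine; exhaustive `2^6` and annealing on 7–10 points: ten), and «L4» a six-member side with at most eleven
  labels of its own (by the data necessarily a blow-up of `C([4],2)` with exactly ten) creates at least two new labels (data: four).
HONEST FRAMING: L3, L4, `AntichainSmallSide`, `AntichainMidRange` and V5 remain OPEN. [this work]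
-/

namespace Summit.CriticalPhenomena.PercolationContinuityZ3.Theorems.SahiColouredDaykin

open Finset

variable {α : Type*} [DecidableEq α]

/-- **Small side, at most four members (unconditional).**  At a point `r` of an antichain with at most four members above `r` and some
member below, `2 #(above) ≤ #meets (above) + #joins (above) + newLabels P r`. [this work] -/
theorem smallSide_of_card_above_le_four {P : Finset (Finset α)} {r : α} (hanti : IsAntichain (· ⊆ ·) (P : Set (Finset α)))
    (hA4 : #(above P r) ≤ 4) (hB : (below P r).Nonempty) :
    2 * #(above P r) ≤ #(meets (above P r)) + #(joins (above P r)) + newLabels P r := by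
  have hantiA := isAntichain_above hanti r
  by_cases hA0 : #(above P r) = 0
  · omega
  have hA : (above P r).Nonempty := card_pos.1 (by omega)
  by_cases hle2 : #(above P r) ≤ 2
  · have h2 := two_le_newLabels_of_min_le_two hanti hA hB (Or.inl hle2)
    have v := two_mul_card_le_of_card_le_three (above P r) hantiA (by omega)
    omega
  by_cases hA3 : #(above P r) = 3
  · have v := two_mul_card_le_of_card_le_three (above P r) hantiA (by omega)
    rcases three_members_trichotomy hantiA hA3 with ⟨K, hK⟩ | ⟨U, hU⟩ | h5
    · have h2 := two_le_newLabels_of_above_sunflower hanti (by omega) hB hK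
      omega
    · have h2 := two_le_newLabels_of_above_cosunflower hanti (by omega) hB hU
      omega
    · have h1 := newLabels_pos_of_card_above_eq_three hanti hA3 hB
      omega
  · have hA4' : #(above P r) = 4 := by omega
    have h7 := seven_le_of_card_eq_four hantiA hA4'
    by_cases h8 : 8 ≤ #(meets (above P r)) + #(joins (above P r))
    · omega
    rcases sunflower_or_cosunflower_of_card_eq_four hantiA hA4' (by omega) with ⟨K, hK⟩ | ⟨U, hU⟩
    · have h2 := two_le_newLabels_of_above_sunflower hanti (by omega) hB hK
      omega
    · have h2 := two_le_newLabels_of_above_cosunflower hanti (by omega) hB hU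
      omega

/-- Dually: **small side below, at most four members (unconditional).** [this work] -/
theorem smallSide_of_card_below_le_four {P : Finset (Finset α)} {r : α} (hanti : IsAntichain (· ⊆ ·) (P : Set (Finset α)))
    (hB4 : #(below P r) ≤ 4) (hA : (above P r).Nonempty) :
    2 * #(below P r) ≤ #(meets (below P r)) + #(joins (below P r)) + newLabels P r := by
  set F := insert r (P.sup id) with hF
  have hP : ∀ a ∈ P, a ⊆ F := subset_insert_sup P r
  have hPB : ∀ a ∈ below P r, a ⊆ F := fun a ha => hP a (below_subset P r ha)
  have hr : r ∈ F := mem_insert_self _ _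
  have h1 := smallSide_of_card_above_le_four (P := P.image (F \ ·)) (r := r) (isAntichain_image_compl hanti hP)
    (by rw [card_above_image_compl hP hr]; exact hB4) (by rw [below_image_compl (P := P) hr]; exact hA.image _)
  rw [newLabels_image_compl hP hr, above_image_compl (P := P) hr, card_image_compl hPB,
    card_meets_add_card_joins_image_compl hPB] at h1
  exact h1

/-- **`AntichainSmallSide` from the two remaining finite lemmas**: «L3» five-member antichains have at least ten labels, and «L4» a
six-member side with at most eleven labels of its own creates at least two new labels. [this work] -/
theorem antichainSmallSide_of
    (h5 : ∀ Q : Finset (Finset α), IsAntichain (· ⊆ ·) (Q : Set (Finset α)) → #Q = 5 → 10 ≤ #(meets Q) + #(joins Q))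
    (h6 : ∀ (P : Finset (Finset α)) (r : α), IsAntichain (· ⊆ ·) (P : Set (Finset α)) → #(above P r) = 6 →
      (below P r).Nonempty → #(meets (above P r)) + #(joins (above P r)) ≤ 11 → 2 ≤ newLabels P r) :
    AntichainSmallSide α := by
  intro P hanti r hA6 hB7
  have hB : (below P r).Nonempty := card_pos.1 (by omega)
  by_cases hA4 : #(above P r) ≤ 4
  · exact smallSide_of_card_above_le_four hanti hA4 hB
  by_cases hA5 : #(above P r) = 5
  · have h10 := h5 (above P r) (isAntichain_above hanti r) hA5
    omega
  · have hA6' : #(above P r) = 6 := by omega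
    have v := two_mul_card_le_of_card_le_six (above P r) (isAntichain_above hanti r) (by omega)
    by_cases h11 : #(meets (above P r)) + #(joins (above P r)) ≤ 11
    · have h2 := h6 P r hanti hA6' hB h11
      omega
    · omega

/-- Hence **V5 follows from `AntichainMidRange`, L3 and L4** (with `two_mul_card_le_of_linear`). [this work] -/
theorem two_mul_card_le_of_midRange_L3_L4 (hM : AntichainMidRange α)
    (h5 : ∀ Q : Finset (Finset α), IsAntichain (· ⊆ ·) (Q : Set (Finset α)) → #Q = 5 → 10 ≤ #(meets Q) + #(joins Q))
    (h6 : ∀ (P : Finset (Finset α)) (r : α), IsAntichain (· ⊆ ·) (P : Set (Finset α)) → #(above P r) = 6 →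
      (below P r).Nonempty → #(meets (above P r)) + #(joins (above P r)) ≤ 11 → 2 ≤ newLabels P r) :
    ∀ P : Finset (Finset α), IsAntichain (· ⊆ ·) (P : Set (Finset α)) → 2 * #P ≤ #(meets P) + #(joins P) + 2 :=
  two_mul_card_le_of_linear hM (antichainSmallSide_of h5 h6)

end Summit.CriticalPhenomena.PercolationContinuityZ3.Theorems.SahiColouredDaykin
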